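import Summits.BirchSwinnertonDyer.Rank1Residual.X11a.PrintDischargeMuAn
import Summits.BirchSwinnertonDyer.BirchSwinnertonDyer.Theorems.Rank1ResidualIntModelReduction
import Summits.BirchSwinnertonDyer.BirchSwinnertonDyer.Theorems.Rank1ResidualX11RankOneReduction
import Literature.NumberTheory.EllipticCurves.Rank1Residual.X9NoEntry
import HarnessLib

/-!
# Route `PrintX11a` (cell `bsd-print-x11a`, seat p2 — booking chore of PLAN v6 §2), child `UpperNonSurjFive`
# (item stmt-BirchSwinnertonDyer-20614) PER PAIR on the HARD sub-locus: the analytic-μ DOOR over a literal integer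
# model (`--supports stmt-BirchSwinnertonDyer-20614`; consumed by `PrintX11aHardLocusRecordsFive3–6.lean`)

HONEST FRAMING. Theorems only; no definition, no named fact, no `sorry`. PER PAIR (E1 currency): nothing here
closes the child `UpperNonSurjFive` (`∀` non-surjective X11a pairs at `5 ≤ p`), which stays OPEN = Greenberg's
`μ`-conjecture on the thin hard family (`Theorems.X11aNonSurjMuAnHardFive`, barrier B3); the leaf `ClassX11a` stays
open; BSD is not proved by any of this. beyond-print theorem: NO.

## What

ty2's part 6 (`X11a/PrintDischargeMuAn.lean`, p552896) gives, on the class `ClassX11a W p` with the image bit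
`¬Surj W p` and the μ-claim `X11a.MuAnZeroAt W p` (= a μ-witness record's `Record.MuClaim`, VERBATIM), the crux-U
currency `Typed.MissingUpperBoundAt W p` modulo TEN named facts (+ Greenberg–Stevens at a split pair), and `BSDp W p`
when moreover `ord_p #Ш_an = 0`. This file packages that door ONCE over a literal integer model `[a₁,…,a₆]` — the
shape of p4's `X11b.bsdp_of_ainvs_of_chaCertificate` (`X11b/ChaPairs1.lean`): the class is ASSEMBLED IN THE KERNEL
from decidable integer data — `p ∣ Δ`, `p ∤ c₄` (`Mult`, Silverman VII.5.1(b)); a good prime `ℓ ≠ p` with kernel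
point count `#Ẽ(𝔽_ℓ) = n` and `X² − (ℓ + 1 − n)X + ℓ` root-free mod `p` (`Irr`, Mazur 1978 Prop. 6.3 (1)); `¬Ram`
from `Irr ∧ ¬Surj` (`not_ram_of_irr_of_not_surj`, Serre 1972 §2.4 Prop. 15); at a non-split pair the node-tangent
quadratic root-free mod `p` (no Greenberg–Stevens binder, ty2 §1c) — leaving DISPLAYED only `r_an = 0`, the
image bit, the μ-claim (and `#Ш_an` for `BSDp`), the ten facts (+ GS at a split pair):
* `classX11a_of_ainvs`, `not_split_of_ainvs`;
* `mub_of_ainvs_of_muAn` ∕ `mub_of_ainvs_of_muAn_of_nonsplit` ⇒ `Typed.MissingUpperBoundAt W p`;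
* `bsdp_of_ainvs_of_muAn` ∕ `bsdp_of_ainvs_of_muAn_of_nonsplit` ⇒ `BSDp W p` at a unit pair.
The per-pair bookings of ty3's `RecordsLeafNonSurjMuPart2.lean` (15 hard pairs at `p = 5`, `115320 ≤ N ≤ 389205`)
are the sequel files `PrintX11aHardLocusRecordsFive3–6.lean` (p3's `Five1/2` book `Part1`).

References: [Kato2004Asterisque] Thm. 12.4 (p. 221), §17.13 (pp. 279–280); [Wuthrich2014] Cor. 18 (p. 398);
[SteinWuthrich2013] Thm. 6.1 (p. 20); [GreenbergLNM1716] Thm. 1.5, Conj. 1.11; [Mazur1978] Prop. 6.3; [Serre1972]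
§2.4 Prop. 15; [SilvermanAEC2009] VII.5.1; [Miller2011LMS] Def. 1.1; cell files `X11b/ChaPairs1.lean` (p4, shape),
`X11a/ChaRecords4.lean` (p3, grammar), `X11a/PrintDischargeMuAn.lean` (ty2), HOME/PLAN.md v6 §2–§3,
HOME/TY2-DISCHARGE-INTERFACE.md §J.
-/

set_option linter.dupNamespace false -- the directory name repeats the summit name (sibling precedent)

set_option autoImplicit false

noncomputable section

open scoped Classical MatrixGroups ModularForm

open WeierstrassCurve Literature.NumberTheory.EllipticCurves
  Literature.NumberTheory.EllipticCurves.ModularForms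
  Literature.NumberTheory.EllipticCurves.Rank1Residual
  Literature.NumberTheory.EllipticCurves.Rank1Residual.Typed
  Literature.NumberTheory.EllipticCurves.Rank1Residual.X11RankOneCertificates
  Literature.NumberTheory.EllipticCurves.Wuthrich2014
  Literature.NumberTheory.EllipticCurves.SteinWuthrich2013
  Literature.NumberTheory.EllipticCurves.Greenberg1999
  Literature.NumberTheory.EllipticCurves.Kato2004
  Summit.BirchSwinnertonDyer.BirchSwinnertonDyer.Rank1Residual.IntModel
  Summit.BirchSwinnertonDyer.BirchSwinnertonDyer.Rank1Residual.X11RankOne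
  Summit.BirchSwinnertonDyer.Rank1Residual
  Summit.BirchSwinnertonDyer.Rank1Residual.X11b

namespace Summit.BirchSwinnertonDyer.BirchSwinnertonDyer.Theorems.HardLocusRecords

/-! ### The door over a literal integer model (ty2 part 6 on `ClassX11a`; the class assembled in the kernel) -/

section Door

variable {W : WeierstrassCurve ℚ} [W.IsElliptic] [W.IsGloballyMinimal]

/-- **`ClassX11a W p` from the integer model `[a₁,…,a₆]` and two displayed bits** (shape of p4's
`X11b.bsdp_of_ainvs_of_chaCertificate`, all Galois ∕ reduction hypotheses from DECIDABLE integer data): `p` odd,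
`p ∣ Δ`, `p ∤ c₄` (multiplicative at `p`), a good prime `ℓ ≠ p` (`ℓ ∤ Δ`) with kernel point count `#Ẽ(𝔽_ℓ) = n` and
`X² − (ℓ + 1 − n)X + ℓ` root-free mod `p` (`E[p]` irreducible, Mazur 1978 Prop. 6.3 (1)); DISPLAYED `r_an = 0` and
`¬Surj W p`; `¬Ram` from `Irr ∧ ¬Surj` (Serre: an irreducible image with a transvection is everything).
[cite: Mazur1978, §6 Prop. 6.3 (1) (p. 153)] [cite: Serre1972, §2.4 Prop. 15] [cite: SilvermanAEC2009, VII.5 Prop. 5.1(b)] -/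
theorem classX11a_of_ainvs
    (a1 a2 a3 a4 a6 : ℤ) (hW : integralModelInt W = ⟨a1, a2, a3, a4, a6⟩) (p ℓ n : ℕ) [Fact p.Prime] [Fact ℓ.Prime]
    (hp2 : p ≠ 2) (hpΔ : (p : ℤ) ∣ discOf [a1, a2, a3, a4, a6]) (hpc4 : ¬ (p : ℤ) ∣ c4Of [a1, a2, a3, a4, a6])
    (hℓp : ℓ ≠ p) (hℓΔ : ¬ (ℓ : ℤ) ∣ discOf [a1, a2, a3, a4, a6])
    (hcard : Nat.card (((⟨a1, a2, a3, a4, a6⟩ : WeierstrassCurve ℤ).map (Int.castRingHom (ZMod ℓ))).toAffine.Point) = n)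
    (hnoroot : ∀ t : ℕ, t < p → ¬ (p : ℤ) ∣ (t : ℤ) ^ 2 - ((ℓ : ℤ) + 1 - n) * t + ℓ)
    (hr : W.analyticRank = 0) (hnsj : ¬ Surj W p) : ClassX11a W p := by
  haveI : NeZero p := ⟨(Fact.out : p.Prime).ne_zero⟩
  have hΔ : (⟨a1, a2, a3, a4, a6⟩ : WeierstrassCurve ℤ).Δ = discOf [a1, a2, a3, a4, a6] := intCurve_Δ a1 a2 a3 a4 a6
  have hc4 : (⟨a1, a2, a3, a4, a6⟩ : WeierstrassCurve ℤ).c₄ = c4Of [a1, a2, a3, a4, a6] := intCurve_c₄ a1 a2 a3 a4 a6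
  have hmult : Mult W p :=
    hasMultiplicativeReductionAtPrime_of_intModel hW p (by rw [hΔ]; exact hpΔ) (by rw [hc4]; exact hpc4)
  have hirr : Irr W p := by
    refine hasIrreducibleModPGaloisRep_of_intModel_of_noroot hW p ℓ hℓp (by rw [hΔ]; exact hℓΔ) hcard
      (forall_zmod_of_forall_lt fun t ht h0 ↦ hnoroot t ht ?_)
    rw [← ZMod.intCast_zmod_eq_zero_iff_dvd]
    push_cast at h0 ⊢
    linear_combination h0
  exact ⟨hr, hp2, hmult, hirr, not_ram_of_irr_of_not_surj W p hirr hnsj⟩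

/-- Non-split multiplicative at `p` from the integer model: the node-tangent quadratic mod `p` is root-free
(`p ∣ Δ`, `p ∤ c₄`; Silverman VII.5.1(b), tree `not_hasSplitMultiplicativeReductionAtPrime_of_intModel_of_noroot`).
[cite: SilvermanAEC2009, VII.5 Prop. 5.1(b)] -/
theorem not_split_of_ainvs (a1 a2 a3 a4 a6 : ℤ) (hW : integralModelInt W = ⟨a1, a2, a3, a4, a6⟩) (p : ℕ) [Fact p.Prime]
    (hpΔ : (p : ℤ) ∣ discOf [a1, a2, a3, a4, a6]) (hpc4 : ¬ (p : ℤ) ∣ c4Of [a1, a2, a3, a4, a6])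
    (hnodal : letI E₀ : WeierstrassCurve ℤ := ⟨a1, a2, a3, a4, a6⟩
      ∀ t : ZMod p, (E₀.c₄ : ZMod p) * t ^ 2 + (E₀.a₁ * E₀.c₄ : ZMod p) * t
        - (54 * E₀.b₆ - 3 * E₀.b₂ * E₀.b₄ + E₀.a₂ * E₀.c₄ : ZMod p) ≠ 0)
    : ¬ W.HasSplitMultiplicativeReductionAtPrime p :=
  not_hasSplitMultiplicativeReductionAtPrime_of_intModel_of_noroot hW p (by rw [intCurve_Δ]; exact hpΔ)
    (by rw [intCurve_c₄]; exact hpc4) hnodal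

/-- **The μ-claim door over a literal integer model** (`Typed.MissingUpperBoundAt W p`): `classX11a_of_ainvs` + ty2's
`ClassX11a.missingUpperBoundAt_of_muAnZeroAt_of_not_surj` (ten facts + Greenberg–Stevens at the pair + the image bit + the
μ-claim `X11a.MuAnZeroAt W p`). Per pair; not a class theorem. [cite: Kato2004Asterisque, Thm. 12.4 (p. 221) and §17.13 (pp. 279–280)]
[cite: Wuthrich2014, Cor. 18 (p. 398)] [cite: SteinWuthrich2013, Thm. 6.1 (p. 20)] [cite: Miller2011LMS, Def. 1.1] -/
theorem mub_of_ainvs_of_muAn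
    (hJs : thm61_splitMultiplicative) (hJn : thm61_nonsplitMultiplicative)
    (hGZK : rank_eq_analyticRank_of_analyticRank_le_one) (hpar : nonempty_modularParametrizationData)
    (h12 : Kato2004.thm12_4)
    (hns : Kato2004.exists_multDivisibilityInputs_nonsplit)
    (hsp : Kato2004.exists_multDivisibilityInputs_split)
    (h15 : thm15_isTorsion_multiplicative_rat)
    (h18 : Wuthrich2014.corollary18_padicLFunction_mem_iwasawaAlgebra_multiplicative)
    (hfine : Kato2004.exists_multDivisibilityInputs_fine)
    (a1 a2 a3 a4 a6 : ℤ) (hW : integralModelInt W = ⟨a1, a2, a3, a4, a6⟩) (p ℓ n : ℕ) [Fact p.Prime] [Fact ℓ.Prime]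
    (hp2 : p ≠ 2) (hpΔ : (p : ℤ) ∣ discOf [a1, a2, a3, a4, a6]) (hpc4 : ¬ (p : ℤ) ∣ c4Of [a1, a2, a3, a4, a6])
    (hℓp : ℓ ≠ p) (hℓΔ : ¬ (ℓ : ℤ) ∣ discOf [a1, a2, a3, a4, a6])
    (hcard : Nat.card (((⟨a1, a2, a3, a4, a6⟩ : WeierstrassCurve ℤ).map (Int.castRingHom (ZMod ℓ))).toAffine.Point) = n)
    (hnoroot : ∀ t : ℕ, t < p → ¬ (p : ℤ) ∣ (t : ℤ) ^ 2 - ((ℓ : ℤ) + 1 - n) * t + ℓ)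
    (hGS : greenberg_stevens (W := W) (p := p))
    (hr : W.analyticRank = 0) (hnsj : ¬ Surj W p) (hμ : X11a.MuAnZeroAt W p) : MissingUpperBoundAt W p :=
  (classX11a_of_ainvs a1 a2 a3 a4 a6 hW p ℓ n hp2 hpΔ hpc4 hℓp hℓΔ hcard hnoroot hr hnsj).missingUpperBoundAt_of_muAnZeroAt_of_not_surj
    hJs hJn hGZK hpar h12 hns hsp h15 h18 hfine hGS hnsj hμ

/-- **`BSD(E,p)` over a literal integer model at a UNIT pair** (`#Ш_an = q`, `ord_p q = 0`, displayed): the μ-claim door for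
the upper half, the free lower half (ty2's `ClassX11a.bsdp_of_muAnZeroAt_of_not_surj_of_unit`). Per pair.
[cite: Miller2011LMS, §1 and Def. 1.1] [cite: Kato2004Asterisque, §17.13 (pp. 279–280)] [cite: Wuthrich2014, Cor. 18 (p. 398)] -/
theorem bsdp_of_ainvs_of_muAn
    (hJs : thm61_splitMultiplicative) (hJn : thm61_nonsplitMultiplicative)
    (hGZK : rank_eq_analyticRank_of_analyticRank_le_one) (hpar : nonempty_modularParametrizationData)
    (h12 : Kato2004.thm12_4)
    (hns : Kato2004.exists_multDivisibilityInputs_nonsplit)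
    (hsp : Kato2004.exists_multDivisibilityInputs_split)
    (h15 : thm15_isTorsion_multiplicative_rat)
    (h18 : Wuthrich2014.corollary18_padicLFunction_mem_iwasawaAlgebra_multiplicative)
    (hfine : Kato2004.exists_multDivisibilityInputs_fine)
    (a1 a2 a3 a4 a6 : ℤ) (hW : integralModelInt W = ⟨a1, a2, a3, a4, a6⟩) (p ℓ n : ℕ) [Fact p.Prime] [Fact ℓ.Prime]
    (hp2 : p ≠ 2) (hpΔ : (p : ℤ) ∣ discOf [a1, a2, a3, a4, a6]) (hpc4 : ¬ (p : ℤ) ∣ c4Of [a1, a2, a3, a4, a6])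
    (hℓp : ℓ ≠ p) (hℓΔ : ¬ (ℓ : ℤ) ∣ discOf [a1, a2, a3, a4, a6])
    (hcard : Nat.card (((⟨a1, a2, a3, a4, a6⟩ : WeierstrassCurve ℤ).map (Int.castRingHom (ZMod ℓ))).toAffine.Point) = n)
    (hnoroot : ∀ t : ℕ, t < p → ¬ (p : ℤ) ∣ (t : ℤ) ^ 2 - ((ℓ : ℤ) + 1 - n) * t + ℓ)
    (hGS : greenberg_stevens (W := W) (p := p))
    (hr : W.analyticRank = 0) (hnsj : ¬ Surj W p) (hμ : X11a.MuAnZeroAt W p)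
    {q : ℚ} (hq : shaAn W = (q : ℂ)) (hv : padicValRat p q = 0) : BSDp W p :=
  (classX11a_of_ainvs a1 a2 a3 a4 a6 hW p ℓ n hp2 hpΔ hpc4 hℓp hℓΔ hcard hnoroot hr hnsj).bsdp_of_muAnZeroAt_of_not_surj_of_unit
    hJs hJn hGZK hpar h12 hns hsp h15 h18 hfine hGS hnsj hμ hq hv

/-- **The μ-claim door over a literal integer model at a NON-SPLIT pair, no Greenberg–Stevens binder**: the node-tangent
quadratic mod `p` is root-free (kernel), so `p` is non-split and ty2's `…_of_nonsplit` variant applies (GS is vacuous at a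
non-split prime). Per pair. [cite: SilvermanAEC2009, VII.5 Prop. 5.1(b)] [cite: Kato2004Asterisque, Thm. 12.4 (p. 221) and §17.13 (pp. 279–280)]
[cite: Wuthrich2014, Cor. 18 (p. 398)] [cite: Miller2011LMS, Def. 1.1] -/
theorem mub_of_ainvs_of_muAn_of_nonsplit
    (hJs : thm61_splitMultiplicative) (hJn : thm61_nonsplitMultiplicative)
    (hGZK : rank_eq_analyticRank_of_analyticRank_le_one) (hpar : nonempty_modularParametrizationData)
    (h12 : Kato2004.thm12_4)
    (hns : Kato2004.exists_multDivisibilityInputs_nonsplit)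
    (hsp : Kato2004.exists_multDivisibilityInputs_split)
    (h15 : thm15_isTorsion_multiplicative_rat)
    (h18 : Wuthrich2014.corollary18_padicLFunction_mem_iwasawaAlgebra_multiplicative)
    (hfine : Kato2004.exists_multDivisibilityInputs_fine)
    (a1 a2 a3 a4 a6 : ℤ) (hW : integralModelInt W = ⟨a1, a2, a3, a4, a6⟩) (p ℓ n : ℕ) [Fact p.Prime] [Fact ℓ.Prime]
    (hp2 : p ≠ 2) (hpΔ : (p : ℤ) ∣ discOf [a1, a2, a3, a4, a6]) (hpc4 : ¬ (p : ℤ) ∣ c4Of [a1, a2, a3, a4, a6])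
    (hℓp : ℓ ≠ p) (hℓΔ : ¬ (ℓ : ℤ) ∣ discOf [a1, a2, a3, a4, a6])
    (hcard : Nat.card (((⟨a1, a2, a3, a4, a6⟩ : WeierstrassCurve ℤ).map (Int.castRingHom (ZMod ℓ))).toAffine.Point) = n)
    (hnoroot : ∀ t : ℕ, t < p → ¬ (p : ℤ) ∣ (t : ℤ) ^ 2 - ((ℓ : ℤ) + 1 - n) * t + ℓ)
    (hnodal : letI E₀ : WeierstrassCurve ℤ := ⟨a1, a2, a3, a4, a6⟩
      ∀ t : ZMod p, (E₀.c₄ : ZMod p) * t ^ 2 + (E₀.a₁ * E₀.c₄ : ZMod p) * t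
        - (54 * E₀.b₆ - 3 * E₀.b₂ * E₀.b₄ + E₀.a₂ * E₀.c₄ : ZMod p) ≠ 0)
    (hr : W.analyticRank = 0) (hnsj : ¬ Surj W p) (hμ : X11a.MuAnZeroAt W p) : MissingUpperBoundAt W p :=
  (classX11a_of_ainvs a1 a2 a3 a4 a6 hW p ℓ n hp2 hpΔ hpc4 hℓp hℓΔ hcard hnoroot hr hnsj).missingUpperBoundAt_of_muAnZeroAt_of_not_surj_of_nonsplit
    hJs hJn hGZK hpar h12 hns hsp h15 h18 hfine hnsj (not_split_of_ainvs a1 a2 a3 a4 a6 hW p hpΔ hpc4 hnodal) hμ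

/-- **`BSD(E,p)` over a literal integer model at a NON-SPLIT UNIT pair, no Greenberg–Stevens binder** (ty2's
`…_of_nonsplit_of_unit`). Per pair. [cite: Miller2011LMS, §1 and Def. 1.1] [cite: SilvermanAEC2009, VII.5 Prop. 5.1(b)]
[cite: Kato2004Asterisque, §17.13 (pp. 279–280)] [cite: Wuthrich2014, Cor. 18 (p. 398)] -/
theorem bsdp_of_ainvs_of_muAn_of_nonsplit
    (hJs : thm61_splitMultiplicative) (hJn : thm61_nonsplitMultiplicative)
    (hGZK : rank_eq_analyticRank_of_analyticRank_le_one) (hpar : nonempty_modularParametrizationData)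
    (h12 : Kato2004.thm12_4)
    (hns : Kato2004.exists_multDivisibilityInputs_nonsplit)
    (hsp : Kato2004.exists_multDivisibilityInputs_split)
    (h15 : thm15_isTorsion_multiplicative_rat)
    (h18 : Wuthrich2014.corollary18_padicLFunction_mem_iwasawaAlgebra_multiplicative)
    (hfine : Kato2004.exists_multDivisibilityInputs_fine)
    (a1 a2 a3 a4 a6 : ℤ) (hW : integralModelInt W = ⟨a1, a2, a3, a4, a6⟩) (p ℓ n : ℕ) [Fact p.Prime] [Fact ℓ.Prime]
    (hp2 : p ≠ 2) (hpΔ : (p : ℤ) ∣ discOf [a1, a2, a3, a4, a6]) (hpc4 : ¬ (p : ℤ) ∣ c4Of [a1, a2, a3, a4, a6])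
    (hℓp : ℓ ≠ p) (hℓΔ : ¬ (ℓ : ℤ) ∣ discOf [a1, a2, a3, a4, a6])
    (hcard : Nat.card (((⟨a1, a2, a3, a4, a6⟩ : WeierstrassCurve ℤ).map (Int.castRingHom (ZMod ℓ))).toAffine.Point) = n)
    (hnoroot : ∀ t : ℕ, t < p → ¬ (p : ℤ) ∣ (t : ℤ) ^ 2 - ((ℓ : ℤ) + 1 - n) * t + ℓ)
    (hnodal : letI E₀ : WeierstrassCurve ℤ := ⟨a1, a2, a3, a4, a6⟩
      ∀ t : ZMod p, (E₀.c₄ : ZMod p) * t ^ 2 + (E₀.a₁ * E₀.c₄ : ZMod p) * t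
        - (54 * E₀.b₆ - 3 * E₀.b₂ * E₀.b₄ + E₀.a₂ * E₀.c₄ : ZMod p) ≠ 0)
    (hr : W.analyticRank = 0) (hnsj : ¬ Surj W p) (hμ : X11a.MuAnZeroAt W p)
    {q : ℚ} (hq : shaAn W = (q : ℂ)) (hv : padicValRat p q = 0) : BSDp W p :=
  (classX11a_of_ainvs a1 a2 a3 a4 a6 hW p ℓ n hp2 hpΔ hpc4 hℓp hℓΔ hcard hnoroot hr hnsj).bsdp_of_muAnZeroAt_of_not_surj_of_nonsplit_of_unit
    hJs hJn hGZK hpar h12 hns hsp h15 h18 hfine hnsj (not_split_of_ainvs a1 a2 a3 a4 a6 hW p hpΔ hpc4 hnodal) hμ hq hv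

end Door

end Summit.BirchSwinnertonDyer.BirchSwinnertonDyer.Theorems.HardLocusRecords

end
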